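import Literature.Analysis.FluidPDE.StatisticalSolutionProofs
import Literature.Analysis.FunctionSpaces.TorusEnstrophyOrthogonality
import HarnessLib

/-!
# One-sided strain bounds for the inertial pairing and weak duality for stress carriers on `T^d`

Support file (all proved, no named facts) for the ENERGY AXIS of the crux `PumpedMirror.MirrorFloorTG`
(cell `ad-ideate`, seat ad-p3 ROUND-7 §1(b) «provable now» objects `OneSidedPlugInTG`, `StressCarrierCeiling`,
`PointwiseGivesStrainBounded`; typed there over `Torus.fderiv`, `Torus.partialDeriv`, `Torus.inertialPairing`).

The landed plug-in theorem `floor_uniform_of_stressBound` (Theorems/PumpedMirrorMirrorFloorTGExplicitEnergy) takes a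
TWO-SIDED pointwise stress bound `|⟪∇w(x)v,v⟫| ≤ K|v|²` and turns it into `|I_w(u)| ≤ K‖u‖²` by
`norm_integral_le_of_norm_le` (no integrability needed); its proof then uses only the lower half
`−K‖u‖² ≤ I_w(u)`.  The ONE-SIDED hypothesis `−Λ|v|² ≤ ⟪∇w(x)v,v⟫` (symmetric gradient bounded BELOW, the
Michell / linear-certificate cone `Def w ⪰ −Λ I`) gives the same lower bound, but through `integral_mono`, which needs
the integrand `x ↦ ⟪∇w(x)u(x),u(x)⟫` to be integrable for `u ∈ L²` — proved here from the continuity of `∇w` on the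
compact torus (§2).  Contents:

* §1 pointwise algebra: `⟪∇g(x)v,v⟫ = ∑ⱼ∑ₖ vⱼvₖ ∂ⱼgₖ(x)` (the coordinate form `(v ⊗ v) : ∇g` used in weak steady
  Euler / Reynolds-stress identities), `∑ⱼ ⟪∇g(x)eⱼ,eⱼ⟫ = div g(x)`, and the sign facts: a one-sided strain bound
  `−Λ|v|² ≤ ⟪∇g(x)v,v⟫` at ONE point of a divergence-free `g` forces `0 ≤ Λ` (trace zero), a two-sided bound forces
  `0 ≤ K`;
* §2 integrability of `⟪∇g(x)u(x),u(x)⟫` for `C¹` `g` and `u ∈ L²`, with the bound `C‖u(x)‖²`;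
* §3 the one-sided `L²` bounds `−Λ‖u‖² ≤ I_g(u)` / `I_g(u) ≤ Λ‖u‖²` for `Torus.inertialPairing` from the pointwise
  one-sided bounds (the twin of `abs_inertialPairing_le_of_pointwise`);
* §4 **weak duality for finite-rank `L²` stress carriers** (Michell / Beckmann, solenoidal gauge): if
  `τ = ∑ᵢ vᵢ ⊗ vᵢ` with `vᵢ ∈ L²`, `∑ᵢ∫|vᵢ|² ≤ m`, carries the load `f` in the pressure-free weak sense tested
  against `g` — `∑ᵢ ∫ (vᵢ ⊗ vᵢ) : ∇g + ∫ ⟪f, g⟫ = 0` — and `Def g ⪰ −Λ I` pointwise with `div g = 0`, then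
  `∫⟪f,g⟫ ≤ Λ·m`; two-sided version `|∫⟪f,g⟫| ≤ K·m`.  This is the elementary inequality half
  (`max ≤ min`) of the Michell-truss duality `min{∫ρ⁰(σ) : −div σ = F} = max{⟨u,F⟩ : ρ(e(u)) ≤ 1}`
  (Bouchitté–Gangbo–Seppecher 2008, (2.21) and Prop. 2.1), here on the flat torus, with solenoidal test fields
  (pressure gauge) and the one-sided cone `τ ⪰ 0` / `Def g ⪰ −I` in place of the symmetric gauge `ρ`.

## References

* G. Bouchitté, W. Gangbo, P. Seppecher, *Michell trusses and lines of principal action*, Math. Models Methods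
  Appl. Sci. 18 (2008) 1571–1603, §2.4–2.5, (2.19)–(2.25), Prop. 2.1. [`BouchitteGangboSeppecher2008`]
* G. Bouchitté, G. Buttazzo, *Characterization of optimal shapes and masses through Monge–Kantorovich equation*,
  J. Eur. Math. Soc. 3 (2001) 139–168, §2 (2.11)–(2.12), Thm. 2.3. [`BouchitteButtazzo2001`]
* C. Foias, O. Manley, R. Rosa, R. Temam, *Navier–Stokes Equations and Turbulence*, CUP 2001, Ch. IV §1.1
  (1.7)–(1.9) (the trilinear form; `Torus.inertialPairing`). [`FMRTTurbulence2001`]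
-/

open MeasureTheory
open scoped InnerProductSpace RealInnerProductSpace

noncomputable section

namespace Literature.Analysis.FluidPDE

namespace Torus

open FunctionSpaces FunctionSpaces.Torus

variable {d : Type*} [Fintype d] [DecidableEq d]

/-! ## §1 Pointwise algebra of the strain quadratic form -/

/-- The strain quadratic form in coordinates: `⟪∇g(x) v, v⟫ = ∑ⱼ ∑ₖ vⱼ vₖ ∂ⱼ gₖ(x)` for `C¹` `g`
(`∇g(x) v = ∑ⱼ vⱼ ∂ⱼ g(x)` and `(∂ⱼ g(x))ₖ = ∂ⱼ gₖ(x)`), i.e. the contraction `(v ⊗ v) : ∇g` of the rank-one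
stress `v ⊗ v` with the velocity gradient. [cite: FMRTTurbulence2001, Ch. IV §1.1 (1.7)–(1.9) (b(u,v,w) in coordinates)] -/
theorem inner_fderiv_apply_self_eq_sum {g : UnitAddTorus d → EuclideanSpace ℝ d}
    (hg : FunctionSpaces.Torus.IsContDiff 1 g) (x : UnitAddTorus d) (v : EuclideanSpace ℝ d) :
    ⟪Torus.fderiv g x v, v⟫_ℝ = ∑ j, ∑ k, v j * v k * FunctionSpaces.Torus.partialDeriv j (fun y => g y k) x := by
  rw [FunctionSpaces.Torus.fderiv_apply_eq_sum_partialDeriv hg, sum_inner]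
  refine Finset.sum_congr rfl fun j _ => ?_
  have h : ⟪FunctionSpaces.Torus.partialDeriv j g x, v⟫_ℝ =
      ∑ k, FunctionSpaces.Torus.partialDeriv j (fun y => g y k) x * v k := by
    rw [PiLp.inner_apply]
    refine Finset.sum_congr rfl fun k _ => ?_
    rw [FunctionSpaces.Torus.partialDeriv_apply_coord hg]
    simp [mul_comm]
  rw [real_inner_smul_left, h, Finset.mul_sum]
  refine Finset.sum_congr rfl fun k _ => ?_
  ring

/-- The trace of the strain form over the standard basis is the divergence:
`∑ⱼ ⟪∇g(x) eⱼ, eⱼ⟫ = div g (x)` for `C¹` `g`. [cite: FMRTTurbulence2001, Ch. IV §1.1 (1.7)–(1.9)] -/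
theorem sum_inner_fderiv_single_eq_divergence {g : UnitAddTorus d → EuclideanSpace ℝ d} (hg : FunctionSpaces.Torus.IsContDiff 1 g)
    (x : UnitAddTorus d) :
    ∑ j, ⟪Torus.fderiv g x (EuclideanSpace.single j (1 : ℝ)), EuclideanSpace.single j (1 : ℝ)⟫_ℝ =
      FunctionSpaces.Torus.divergence g x := by
  rw [FunctionSpaces.Torus.divergence_eq_trace_fderiv hg, LinearMap.trace_eq_sum_inner _ (EuclideanSpace.basisFun d ℝ)]
  refine Finset.sum_congr rfl fun j _ => ?_
  rw [real_inner_comm]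
  simp

/-- **A one-sided strain bound has a non-negative constant.** If `g` is `C¹` and divergence free and at some point
`x` its symmetric gradient is bounded below, `−Λ|v|² ≤ ⟪∇g(x)v, v⟫` for all `v`, then `0 ≤ Λ` (sum over the
standard basis: `0 = div g(x) ≥ −Λ · d`; needs `d` non-empty). [cite: BouchitteGangboSeppecher2008, §2.4 (2.19)–(2.20) (ρ, ρ⁰ ≥ 0)] -/
theorem nonneg_of_neg_mul_le_inner_fderiv [Nonempty d] {g : UnitAddTorus d → EuclideanSpace ℝ d}
    (hg : FunctionSpaces.Torus.IsContDiff 1 g) (hdiv : FunctionSpaces.Torus.IsDivFree g) {Λ : ℝ} {x : UnitAddTorus d}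
    (h : ∀ v : EuclideanSpace ℝ d, -(Λ * ‖v‖ ^ 2) ≤ ⟪Torus.fderiv g x v, v⟫_ℝ) : 0 ≤ Λ := by
  have hsum : ∑ j : d, -(Λ * ‖EuclideanSpace.single j (1 : ℝ)‖ ^ 2) ≤
      ∑ j : d, ⟪Torus.fderiv g x (EuclideanSpace.single j (1 : ℝ)), EuclideanSpace.single j (1 : ℝ)⟫_ℝ :=
    Finset.sum_le_sum fun j _ => h _
  rw [sum_inner_fderiv_single_eq_divergence hg, hdiv x] at hsum
  simp only [PiLp.norm_single, norm_one, one_pow, mul_one, Finset.sum_neg_distrib,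
    Finset.sum_const, Finset.card_univ, nsmul_eq_mul] at hsum
  have hcard : (0 : ℝ) < Fintype.card d := Nat.cast_pos.mpr Fintype.card_pos
  nlinarith

/-- A two-sided strain bound has a non-negative constant: `|⟪∇g(x)v,v⟫| ≤ K|v|²` for all `v` at one point
forces `0 ≤ K` (test `v = e_j`; needs `d` non-empty). [cite: BouchitteGangboSeppecher2008, §2.4 (2.19)–(2.20) (ρ, ρ⁰ ≥ 0)] -/
theorem nonneg_of_abs_inner_fderiv_le [Nonempty d] {g : UnitAddTorus d → EuclideanSpace ℝ d} {K : ℝ}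
    {x : UnitAddTorus d} (h : ∀ v : EuclideanSpace ℝ d, |⟪Torus.fderiv g x v, v⟫_ℝ| ≤ K * ‖v‖ ^ 2) :
    0 ≤ K := by
  obtain ⟨j⟩ := ‹Nonempty d›
  have h1 := h (EuclideanSpace.single j (1 : ℝ))
  rw [PiLp.norm_single, norm_one, one_pow, mul_one] at h1
  exact (abs_nonneg _).trans h1

/-! ## §2 Integrability of the strain form against an `L²` field -/

omit [DecidableEq d] in
/-- The torus derivative of a `C¹` map on the compact torus is bounded: `‖∇g(x)‖ ≤ C` for some `C ≥ 0`.
[cite: FMRTTurbulence2001, Ch. IV §1.1 (1.7)–(1.9)] -/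
theorem exists_norm_fderiv_le {F : Type*} [NormedAddCommGroup F] [NormedSpace ℝ F]
    {g : UnitAddTorus d → F} (hg : FunctionSpaces.Torus.IsContDiff 1 g) : ∃ C : ℝ, 0 ≤ C ∧ ∀ x, ‖Torus.fderiv g x‖ ≤ C := by
  have hc : Continuous (Torus.fderiv g) := by
    have h : FunctionSpaces.Torus.lift (Torus.fderiv g) = _root_.fderiv ℝ (FunctionSpaces.Torus.lift g) :=
      funext fun y => (FunctionSpaces.Torus.fderiv_lift g y).symm
    rw [← FunctionSpaces.Torus.continuous_lift_iff, h]
    exact ContDiff.continuous_fderiv hg one_ne_zero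
  obtain ⟨C, hC⟩ := isCompact_univ.exists_bound_of_continuousOn hc.continuousOn
  exact ⟨max C 0, le_max_right _ _, fun x => (hC x (Set.mem_univ x)).trans (le_max_left _ _)⟩

omit [DecidableEq d] in
/-- Pointwise bound `|⟪∇g(x)w, w⟫| ≤ ‖∇g(x)‖ ‖w‖²`. [cite: FMRTTurbulence2001, Ch. IV §1.1 (1.7)–(1.9)] -/
theorem abs_inner_fderiv_apply_self_le (g : UnitAddTorus d → EuclideanSpace ℝ d) (x : UnitAddTorus d)
    (w : EuclideanSpace ℝ d) : |⟪Torus.fderiv g x w, w⟫_ℝ| ≤ ‖Torus.fderiv g x‖ * ‖w‖ ^ 2 := by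
  calc |⟪Torus.fderiv g x w, w⟫_ℝ| ≤ ‖Torus.fderiv g x w‖ * ‖w‖ := abs_real_inner_le_norm _ _
    _ ≤ ‖Torus.fderiv g x‖ * ‖w‖ * ‖w‖ :=
        mul_le_mul_of_nonneg_right (ContinuousLinearMap.le_opNorm _ _) (norm_nonneg _)
    _ = ‖Torus.fderiv g x‖ * ‖w‖ ^ 2 := by ring

omit [DecidableEq d] in
/-- The strain form of a `C¹` field against an `L²` field is (strongly) measurable.
[cite: FMRTTurbulence2001, Ch. IV §1.1 (1.7)–(1.9)] -/
theorem aestronglyMeasurable_inner_fderiv_apply_self {g : UnitAddTorus d → EuclideanSpace ℝ d}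
    (hg : FunctionSpaces.Torus.IsContDiff 1 g) {u : UnitAddTorus d → EuclideanSpace ℝ d} (hu : AEStronglyMeasurable u volume) :
    AEStronglyMeasurable (fun x => ⟪Torus.fderiv g x (u x), u x⟫_ℝ) volume := by
  have hc : Continuous (Torus.fderiv g) := by
    have h : FunctionSpaces.Torus.lift (Torus.fderiv g) = _root_.fderiv ℝ (FunctionSpaces.Torus.lift g) :=
      funext fun y => (FunctionSpaces.Torus.fderiv_lift g y).symm
    rw [← FunctionSpaces.Torus.continuous_lift_iff, h]
    exact ContDiff.continuous_fderiv hg one_ne_zero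
  have h1 : AEStronglyMeasurable (fun x => Torus.fderiv g x (u x)) (volume : Measure (UnitAddTorus d)) :=
    (ContinuousLinearMap.id ℝ (EuclideanSpace ℝ d →L[ℝ] EuclideanSpace ℝ d)).aestronglyMeasurable_comp₂
      hc.aestronglyMeasurable hu
  exact h1.inner hu

omit [DecidableEq d] in
/-- **Integrability of the strain form against an `L²` field**: for `C¹` `g` and `u ∈ L²(T^d; ℝ^d)` the function
`x ↦ ⟪∇g(x)u(x), u(x)⟫` is integrable (dominated by `(sup‖∇g‖) ‖u(x)‖²`). [cite: FMRTTurbulence2001, Ch. IV §1.1 (1.7)–(1.9) (b(u,u,w) is defined for u ∈ L², w ∈ C¹)] -/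
theorem integrable_inner_fderiv_apply_self {g : UnitAddTorus d → EuclideanSpace ℝ d}
    (hg : FunctionSpaces.Torus.IsContDiff 1 g) {u : UnitAddTorus d → EuclideanSpace ℝ d}
    (hu : MemLp u 2 volume) :
    Integrable (fun x => ⟪Torus.fderiv g x (u x), u x⟫_ℝ) volume := by
  obtain ⟨C, hC0, hC⟩ := exists_norm_fderiv_le hg
  have h2 : Integrable (fun x => C * ‖u x‖ ^ 2) volume := (hu.integrable_norm_pow two_ne_zero).const_mul C
  refine h2.mono' (aestronglyMeasurable_inner_fderiv_apply_self hg hu.aestronglyMeasurable)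
    (Filter.Eventually.of_forall fun x => ?_)
  rw [Real.norm_eq_abs]
  exact (abs_inner_fderiv_apply_self_le g x (u x)).trans
    (mul_le_mul_of_nonneg_right (hC x) (sq_nonneg _))

omit [DecidableEq d] in
/-- One-sided pointwise bound, integrated: `−Λ|v|² ≤ ⟪∇g(x)v,v⟫` for all `x, v` gives
`−Λ ∫‖u‖² ≤ ∫ ⟪∇g u, u⟫` for `u ∈ L²`. [cite: BouchitteGangboSeppecher2008, §2.5 (2.21) (pointwise ⇒ integrated duality pairing)] -/
theorem neg_mul_integral_norm_sq_le_integral_inner_fderiv {g : UnitAddTorus d → EuclideanSpace ℝ d}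
    (hg : FunctionSpaces.Torus.IsContDiff 1 g) {Λ : ℝ}
    (hΛ : ∀ (x : UnitAddTorus d) (v : EuclideanSpace ℝ d), -(Λ * ‖v‖ ^ 2) ≤ ⟪Torus.fderiv g x v, v⟫_ℝ)
    {u : UnitAddTorus d → EuclideanSpace ℝ d} (hu : MemLp u 2 volume) :
    -(Λ * ∫ x, ‖u x‖ ^ 2) ≤ ∫ x, ⟪Torus.fderiv g x (u x), u x⟫_ℝ := by
  rw [← integral_const_mul, ← integral_neg]
  exact integral_mono ((hu.integrable_norm_pow two_ne_zero).const_mul Λ).neg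
    (integrable_inner_fderiv_apply_self hg hu) fun x => hΛ x (u x)

omit [DecidableEq d] in
/-- Upper one-sided pointwise bound, integrated: `⟪∇g(x)v,v⟫ ≤ Λ|v|²` for all `x, v` gives
`∫ ⟪∇g u, u⟫ ≤ Λ ∫‖u‖²` for `u ∈ L²`. [cite: BouchitteGangboSeppecher2008, §2.5 (2.21)] -/
theorem integral_inner_fderiv_le_mul_integral_norm_sq {g : UnitAddTorus d → EuclideanSpace ℝ d}
    (hg : FunctionSpaces.Torus.IsContDiff 1 g) {Λ : ℝ}
    (hΛ : ∀ (x : UnitAddTorus d) (v : EuclideanSpace ℝ d), ⟪Torus.fderiv g x v, v⟫_ℝ ≤ Λ * ‖v‖ ^ 2)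
    {u : UnitAddTorus d → EuclideanSpace ℝ d} (hu : MemLp u 2 volume) :
    ∫ x, ⟪Torus.fderiv g x (u x), u x⟫_ℝ ≤ Λ * ∫ x, ‖u x‖ ^ 2 := by
  rw [← integral_const_mul]
  exact integral_mono (integrable_inner_fderiv_apply_self hg hu)
    ((hu.integrable_norm_pow two_ne_zero).const_mul Λ) fun x => hΛ x (u x)

/-! ## §3 One-sided `L²` bounds for the inertial pairing `I_g(u) = ∫ ⟪∇g u, u⟫` -/

omit [DecidableEq d] in
/-- **One-sided stress bound from a one-sided pointwise bound** (the twin of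
`abs_inertialPairing_le_of_pointwise` that the one-sided plug-in needs): `−Λ|v|² ≤ ⟪∇g(x)v,v⟫` for all `x, v`
and `C¹` `g` give `−Λ‖u‖² ≤ I_g(u)` for every `u ∈ L²(T^d; ℝ^d)`.
[cite: FMRTTurbulence2001, Ch. IV §1.1 (1.7)–(1.9)] [cite: BouchitteGangboSeppecher2008, §2.5 (2.21)] -/
theorem neg_mul_norm_sq_le_inertialPairing_of_pointwise {g : UnitAddTorus d → EuclideanSpace ℝ d}
    (hg : FunctionSpaces.Torus.IsContDiff 1 g) {Λ : ℝ}
    (hΛ : ∀ (x : UnitAddTorus d) (v : EuclideanSpace ℝ d), -(Λ * ‖v‖ ^ 2) ≤ ⟪Torus.fderiv g x v, v⟫_ℝ)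
    (u : Lp (EuclideanSpace ℝ d) 2 (volume : Measure (UnitAddTorus d))) :
    -(Λ * ‖u‖ ^ 2) ≤ inertialPairing u g := by
  rw [inertialPairing, ← integral_norm_sq_coe_eq]
  exact neg_mul_integral_norm_sq_le_integral_inner_fderiv hg hΛ (Lp.memLp u)

omit [DecidableEq d] in
/-- Upper twin: `⟪∇g(x)v,v⟫ ≤ Λ|v|²` for all `x, v` and `C¹` `g` give `I_g(u) ≤ Λ‖u‖²` on `L²`.
[cite: FMRTTurbulence2001, Ch. IV §1.1 (1.7)–(1.9)] [cite: BouchitteGangboSeppecher2008, §2.5 (2.21)] -/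
theorem inertialPairing_le_mul_norm_sq_of_pointwise {g : UnitAddTorus d → EuclideanSpace ℝ d}
    (hg : FunctionSpaces.Torus.IsContDiff 1 g) {Λ : ℝ}
    (hΛ : ∀ (x : UnitAddTorus d) (v : EuclideanSpace ℝ d), ⟪Torus.fderiv g x v, v⟫_ℝ ≤ Λ * ‖v‖ ^ 2)
    (u : Lp (EuclideanSpace ℝ d) 2 (volume : Measure (UnitAddTorus d))) :
    inertialPairing u g ≤ Λ * ‖u‖ ^ 2 := by
  rw [inertialPairing, ← integral_norm_sq_coe_eq]
  exact integral_inner_fderiv_le_mul_integral_norm_sq hg hΛ (Lp.memLp u)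

/-! ## §4 Weak duality for finite-rank `L²` stress carriers (Michell / Beckmann, solenoidal gauge) -/

/-- The carrier identity in `∇g` form: `∑ᵢ ∫ ∑ⱼ∑ₖ (vᵢ)ⱼ(vᵢ)ₖ ∂ⱼgₖ = ∑ᵢ ∫ ⟪∇g vᵢ, vᵢ⟫` for `C¹` `g`.
[cite: FMRTTurbulence2001, Ch. IV §1.1 (1.7)–(1.9)] -/
theorem sum_integral_sum_mul_partialDeriv_eq {N : ℕ} {g : UnitAddTorus d → EuclideanSpace ℝ d}
    (hg : FunctionSpaces.Torus.IsContDiff 1 g) (v : Fin N → UnitAddTorus d → EuclideanSpace ℝ d) :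
    (∑ i, ∫ x, ∑ j, ∑ k, v i x j * v i x k * FunctionSpaces.Torus.partialDeriv j (fun y => g y k) x) =
      ∑ i, ∫ x, ⟪Torus.fderiv g x (v i x), v i x⟫_ℝ := by
  refine Finset.sum_congr rfl fun i _ => integral_congr_ae (Filter.Eventually.of_forall fun x => ?_)
  exact (inner_fderiv_apply_self_eq_sum hg x (v i x)).symm

/-- **Weak duality for stress carriers (one-sided cone).** Let `τ = ∑ᵢ vᵢ ⊗ vᵢ` be a finite-rank Reynolds stress
with `vᵢ ∈ L²(T^d; ℝ^d)` and total mass `∑ᵢ ∫|vᵢ|² ≤ m`, carrying the load `f` against the test field `g` in the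
pressure-free weak sense, `∑ᵢ ∫ (vᵢ ⊗ vᵢ) : ∇g + ∫⟪f, g⟫ = 0`; let `g` be smooth and divergence free with symmetric
gradient bounded below, `−Λ|w|² ≤ ⟪∇g(x)w, w⟫` for all `x, w`.  Then `∫⟪f, g⟫ ≤ Λ · m` (and `0 ≤ Λ`).  Hence a
carrier of mass `m` forbids every linear certificate `Λ E < ∫⟪f,g⟫` at levels `E ≥ m` — the `max ≤ min` half of
Michell's duality, on the torus with solenoidal tests.
[cite: BouchitteGangboSeppecher2008, §2.5 (2.21) and Prop. 2.1 (weak-duality half max ≤ min)] -/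
theorem integral_inner_le_mul_of_stressCarrier [Nonempty d] {N : ℕ} {f g : UnitAddTorus d → EuclideanSpace ℝ d}
    {v : Fin N → UnitAddTorus d → EuclideanSpace ℝ d} {Λ m : ℝ}
    (hg : FunctionSpaces.Torus.IsSmooth g) (hdiv : FunctionSpaces.Torus.IsDivFree g)
    (hstrain : ∀ (x : UnitAddTorus d) (w : EuclideanSpace ℝ d), -(Λ * ‖w‖ ^ 2) ≤ ⟪Torus.fderiv g x w, w⟫_ℝ)
    (hv : ∀ i, MemLp (v i) 2 volume) (hm : ∑ i, ∫ x, ‖v i x‖ ^ 2 ≤ m)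
    (hcar : (∑ i, ∫ x, ∑ j, ∑ k, v i x j * v i x k * FunctionSpaces.Torus.partialDeriv j (fun y => g y k) x) +
      ∫ x, ⟪f x, g x⟫_ℝ = 0) :
    ∫ x, ⟪f x, g x⟫_ℝ ≤ Λ * m := by
  have hg1 : FunctionSpaces.Torus.IsContDiff 1 g := hg.isContDiff (by simp)
  have hΛ : 0 ≤ Λ := nonneg_of_neg_mul_le_inner_fderiv hg1 hdiv (x := 0) (hstrain 0)
  rw [sum_integral_sum_mul_partialDeriv_eq hg1] at hcar
  have hsum : -(Λ * ∑ i, ∫ x, ‖v i x‖ ^ 2) ≤ ∑ i, ∫ x, ⟪Torus.fderiv g x (v i x), v i x⟫_ℝ := by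
    rw [Finset.mul_sum, ← Finset.sum_neg_distrib]
    exact Finset.sum_le_sum fun i _ => neg_mul_integral_norm_sq_le_integral_inner_fderiv hg1 hstrain (hv i)
  have hfg : ∫ x, ⟪f x, g x⟫_ℝ = -∑ i, ∫ x, ⟪Torus.fderiv g x (v i x), v i x⟫_ℝ := by linarith
  rw [hfg]
  nlinarith [mul_le_mul_of_nonneg_left hm hΛ]

/-- **Weak duality for stress carriers (two-sided).** With a two-sided pointwise bound `|⟪∇g(x)w,w⟫| ≤ K|w|²`
(no divergence condition needed) a carrier of mass `m` gives `|∫⟪f,g⟫| ≤ K · m` — the signed Michell problem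
`min ∫∑|λᵢ(τ)|` vs `max{⟨f,u⟩ : max|λᵢ(e(u))| ≤ 1}`. [cite: BouchitteGangboSeppecher2008, §2.4–2.5 (2.19)–(2.21), Prop. 2.1 (max ≤ min)] -/
theorem abs_integral_inner_le_mul_of_stressCarrier [Nonempty d] {N : ℕ}
    {f g : UnitAddTorus d → EuclideanSpace ℝ d} {v : Fin N → UnitAddTorus d → EuclideanSpace ℝ d} {K m : ℝ}
    (hg : FunctionSpaces.Torus.IsSmooth g)
    (hstrain : ∀ (x : UnitAddTorus d) (w : EuclideanSpace ℝ d), |⟪Torus.fderiv g x w, w⟫_ℝ| ≤ K * ‖w‖ ^ 2)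
    (hv : ∀ i, MemLp (v i) 2 volume) (hm : ∑ i, ∫ x, ‖v i x‖ ^ 2 ≤ m)
    (hcar : (∑ i, ∫ x, ∑ j, ∑ k, v i x j * v i x k * FunctionSpaces.Torus.partialDeriv j (fun y => g y k) x) +
      ∫ x, ⟪f x, g x⟫_ℝ = 0) :
    |∫ x, ⟪f x, g x⟫_ℝ| ≤ K * m := by
  have hg1 : FunctionSpaces.Torus.IsContDiff 1 g := hg.isContDiff (by simp)
  have hK : 0 ≤ K := nonneg_of_abs_inner_fderiv_le (x := (0 : UnitAddTorus d)) (hstrain 0)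
  rw [sum_integral_sum_mul_partialDeriv_eq hg1] at hcar
  have hlo : -(K * ∑ i, ∫ x, ‖v i x‖ ^ 2) ≤ ∑ i, ∫ x, ⟪Torus.fderiv g x (v i x), v i x⟫_ℝ := by
    rw [Finset.mul_sum, ← Finset.sum_neg_distrib]
    exact Finset.sum_le_sum fun i _ =>
      neg_mul_integral_norm_sq_le_integral_inner_fderiv hg1 (fun x w => (abs_le.mp (hstrain x w)).1) (hv i)
  have hhi : ∑ i, ∫ x, ⟪Torus.fderiv g x (v i x), v i x⟫_ℝ ≤ K * ∑ i, ∫ x, ‖v i x‖ ^ 2 := by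
    rw [Finset.mul_sum]
    exact Finset.sum_le_sum fun i _ =>
      integral_inner_fderiv_le_mul_integral_norm_sq hg1 (fun x w => (abs_le.mp (hstrain x w)).2) (hv i)
  have hfg : ∫ x, ⟪f x, g x⟫_ℝ = -∑ i, ∫ x, ⟪Torus.fderiv g x (v i x), v i x⟫_ℝ := by linarith
  rw [hfg, abs_le]
  constructor <;> nlinarith [mul_le_mul_of_nonneg_left hm hK]

/-- **Linear-reach ceiling.** In the situation of `integral_inner_le_mul_of_stressCarrier`, no level `E ≥ m` is
certified by `(g, Λ)`: `¬ (Λ E < ∫⟪f,g⟫)`. [cite: BouchitteGangboSeppecher2008, §2.5 Prop. 2.1 (max ≤ min)] -/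
theorem not_mul_lt_integral_inner_of_stressCarrier [Nonempty d] {N : ℕ}
    {f g : UnitAddTorus d → EuclideanSpace ℝ d} {v : Fin N → UnitAddTorus d → EuclideanSpace ℝ d} {Λ m E : ℝ}
    (hg : FunctionSpaces.Torus.IsSmooth g) (hdiv : FunctionSpaces.Torus.IsDivFree g)
    (hstrain : ∀ (x : UnitAddTorus d) (w : EuclideanSpace ℝ d), -(Λ * ‖w‖ ^ 2) ≤ ⟪Torus.fderiv g x w, w⟫_ℝ)
    (hv : ∀ i, MemLp (v i) 2 volume) (hm : ∑ i, ∫ x, ‖v i x‖ ^ 2 ≤ m)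
    (hcar : (∑ i, ∫ x, ∑ j, ∑ k, v i x j * v i x k * FunctionSpaces.Torus.partialDeriv j (fun y => g y k) x) +
      ∫ x, ⟪f x, g x⟫_ℝ = 0)
    (hE : m ≤ E) : ¬ (Λ * E < ∫ x, ⟪f x, g x⟫_ℝ) := by
  have h := integral_inner_le_mul_of_stressCarrier hg hdiv hstrain hv hm hcar
  have hΛ : 0 ≤ Λ :=
    nonneg_of_neg_mul_le_inner_fderiv (hg.isContDiff (by simp)) hdiv (x := 0) (hstrain 0)
  have := mul_le_mul_of_nonneg_left hE hΛ
  exact fun hlt => by linarith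

end Torus

end Literature.Analysis.FluidPDE

end
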